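import Mathlib
import Summits.SmoothPoincare4.SmoothPoincare4.Theorems.CylinderEntropyCylinderRungTwoKCertSoundTab
import HarnessLib

/-!
# Kernel certificate checker for `stub_certMid`, IV-b: soundness of the raw tables and of the effective slopes

Infrastructure file for the kernel-clean discharge of the registered stub `stub_certMid` of crux stmt-SmoothPoincare4-7631
(`Summit.SmoothPoincare4.SmoothPoincare4.Theses.CylinderEntropy.CylinderRungTwo`, line `killing-flux`).  The raw two-sided
zonal tables bracket `Zc θ_i` at the grid angles (`rawTab_spec`), and the verified secant tests make the effective slopes
valid: `0 ≤ mloEff ≤ f'(θ_i) ≤ mhiEff` (convexity of Hamilton's `f`).  No named facts.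
-/

-- the registered namespace `Summit.SmoothPoincare4.SmoothPoincare4.…` repeats a component
set_option linter.dupNamespace false

noncomputable section

namespace Summit.SmoothPoincare4.SmoothPoincare4.Cruxes.CylinderRungTwo.KillingFlux

namespace KCert

open Set
open Summit.SmoothPoincare4.SmoothPoincare4.Theorems.CylinderEntropySliceIsolation.Cert
open Literature.Geometry.Riemannian.SphericalCylinderEntropy

variable (C : KCell)

/-! ### Raw tables -/

/-- The raw table entry at `i < N`. [folklore] -/
theorem rawTab_getD (a : KAtom) {i : ℕ} (hi : i < C.grid.length) :
    (rawTab C a).getD i (0, 0) =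
      (rdn (zlo a.q (C.grid.getD i gridD).s a.K C.prec) C.prec, rup (zhi a.q (C.grid.getD i gridD).s a.K C.prec) C.prec) := by
  unfold rawTab
  rw [List.getD_eq_getElem _ _ (by simpa using hi), List.getElem_map, List.getD_eq_getElem _ _ hi]

/-- The zonal factor at a grid angle is the kernel at the rational `s_i`. [folklore] -/
theorem Zc_theta (a : KAtom) {g : GridPt} (hs1 : -1 ≤ g.s) (hs2 : g.s ≤ 1) :
    a.Zc g.theta = zonal a.tau (g.s : ℝ) := by
  unfold KAtom.Zc GridPt.theta
  rw [Real.cos_arccos (by exact_mod_cast hs1) (by exact_mod_cast hs2)]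

/-- **The raw table brackets the zonal factor at the grid angles**: `0 ≤ lo ≤ Zc θ_i ≤ hi`, `0 < hi`. [folklore] -/
theorem rawTab_spec {a : KAtom} (ha : atomOK C a = true) (hg : gridOK C = true) {i : ℕ} (hi : i < C.grid.length) :
    0 ≤ ((rawTab C a).getD i (0, 0)).1 ∧ ((((rawTab C a).getD i (0, 0)).1 : ℚ) : ℝ) ≤ a.Zc (C.grid.getD i gridD).theta ∧
      a.Zc (C.grid.getD i gridD).theta ≤ ((((rawTab C a).getD i (0, 0)).2 : ℚ) : ℝ) ∧
      (0 : ℝ) < ((((rawTab C a).getD i (0, 0)).2 : ℚ) : ℝ) := by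
  obtain ⟨hq0, hq1, _, _, _, _, hsh⟩ := atomOK_sound C ha
  obtain ⟨_, hpt, _⟩ := gridOK_sound C hg
  obtain ⟨hs1, hs2, _⟩ := hpt i hi
  rw [rawTab_getD C a hi, Zc_theta a hs1 hs2]
  obtain ⟨hlo, hhi, hpos⟩ := zlo_zhi_spec a.K C.prec hq0 hq1 hsh hs1 hs2
  exact ⟨rdn_nonneg (zlo_nonneg _ _ _ _) _, (rdn_le_real _ _).trans hlo, hhi.trans (le_rup_real _ _),
    hpos.trans_le (le_rup_real _ _)⟩

/-! ### The effective slopes -/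

/-- **`0 ≤ mloEff ≤ f'(θ_i)`.** [folklore] -/
theorem mloEff_spec {a : KAtom} (ha : atomOK C a = true) (hg : gridOK C = true) (dlo : List ℚ) {i : ℕ}
    (hi : i < C.grid.length) :
    0 ≤ mloEff C a (rawTab C a) dlo i ∧ ((mloEff C a (rawTab C a) dlo i : ℚ) : ℝ) ≤ a.fd (C.grid.getD i gridD).theta := by
  obtain ⟨_, hpt, _⟩ := gridOK_sound C hg
  have hθ0 : 0 ≤ (C.grid.getD i gridD).theta := le_trans (by exact_mod_cast (hpt i hi).2.2.1) (hpt i hi).2.2.2.1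
  have hfall : 0 ≤ (0 : ℚ) ∧ (((0 : ℚ) : ℚ) : ℝ) ≤ a.fd (C.grid.getD i gridD).theta := ⟨le_rfl, by push_cast; exact fd_nonneg C ha hθ0⟩
  rw [mloEff]
  dsimp only
  split_ifs with h0 hchk
  · exact hfall
  · -- the verified secant to the left
    obtain ⟨hm0, hzi, hbr, hsep, hexp⟩ := hchk
    refine ⟨hm0, ?_⟩
    set gi := C.grid.getD i gridD with hgi
    set gp := C.grid.getD (i - 1) gridD with hgp
    set m := dlo.getD i 0 with hm
    have hτ := tau_pos C ha
    obtain ⟨_, _, _, htlo, htloτ, hτthi, _⟩ := atomOK_sound C ha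
    have hip : i - 1 < C.grid.length := by omega
    have hi' : i - 1 + 1 = i := by omega
    -- real facts at the two grid points
    obtain ⟨_, hlo_i, _, _⟩ := rawTab_spec C ha hg hi
    obtain ⟨_, _, hhi_p, hpos_p⟩ := rawTab_spec C ha hg hip
    rw [← hgi] at hlo_i
    rw [← hgp] at hhi_p
    have hθi := hpt i hi
    have hθp := hpt (i - 1) hip
    rw [← hgi] at hθi
    rw [← hgp] at hθp
    obtain ⟨_, _, htlp0, htlp, hthp, _⟩ := hθp
    obtain ⟨_, _, htli0, htli, hthi, _⟩ := hθi
    have hlt : gp.theta < gi.theta := by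
      have := theta_lt_succ C hg (i := i - 1) (by omega)
      rw [hi'] at this; rwa [← hgi, ← hgp] at this
    -- slope ≤ f'(θ_i)
    have hslope : slope a.f gp.theta gi.theta ≤ a.fd gi.theta :=
      (convexOn_f C ha).slope_le_of_hasDerivAt (mem_univ _) (mem_univ _) hlt (hasDerivAt_f C ha _)
    refine le_trans ?_ hslope
    rw [slope_def_field, le_div_iff₀ (sub_pos.2 hlt)]
    -- need: m (θ_i - θ_p) ≤ f θ_i - f θ_p
    have hzi' : (0 : ℝ) < ((((rawTab C a).getD i (0, 0)).1 : ℚ) : ℝ) := by exact_mod_cast hzi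
    have hZi := Zc_pos C ha gi.theta
    have hZp := Zc_pos C ha gp.theta
    -- logs
    have hlog_i : Real.log ((((rawTab C a).getD i (0, 0)).1 : ℚ) : ℝ) ≤ Real.log (a.Zc gi.theta) :=
      Real.log_le_log hzi' hlo_i
    have hlog_p : Real.log (a.Zc gp.theta) ≤ Real.log ((((rawTab C a).getD (i - 1) (0, 0)).2 : ℚ) : ℝ) :=
      Real.log_le_log hZp hhi_p
    -- the exp check: zp ≤ zi * expLo(B) ≤ zi * e^B
    set B : ℚ := (gi.tlo - gp.thi) * ((gi.tlo + gp.tlo) / (4 * a.thi) - m) with hB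
    have hexpR : ((((rawTab C a).getD (i - 1) (0, 0)).2 : ℚ) : ℝ) ≤
        ((((rawTab C a).getD i (0, 0)).1 : ℚ) : ℝ) * Real.exp (B : ℝ) := by
      have h1 : ((((rawTab C a).getD (i - 1) (0, 0)).2 : ℚ) : ℝ) ≤
          (((((rawTab C a).getD i (0, 0)).1 * expLo B C.prec : ℚ)) : ℝ) := by exact_mod_cast hexp
      push_cast at h1
      exact h1.trans (mul_le_mul_of_nonneg_left (expLo_le _ _) hzi'.le)
    have hlogB : Real.log ((((rawTab C a).getD (i - 1) (0, 0)).2 : ℚ) : ℝ) ≤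
        Real.log ((((rawTab C a).getD i (0, 0)).1 : ℚ) : ℝ) + (B : ℝ) := by
      have := Real.log_le_log hpos_p hexpR
      rwa [Real.log_mul hzi'.ne' (Real.exp_pos _).ne', Real.log_exp] at this
    -- the bracket bound: B ≤ (θ_i² - θ_p²)/(4τ) - m (θ_i - θ_p)
    have hBr : (B : ℝ) ≤ (gi.theta ^ 2 - gp.theta ^ 2) / (4 * a.tau) - (m : ℝ) * (gi.theta - gp.theta) := by
      rw [hB]; push_cast
      have hbr' : (0 : ℝ) ≤ ((gi.tlo : ℝ) + gp.tlo) / (4 * a.thi) - m := by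
        have : (0 : ℝ) ≤ (((gi.tlo + gp.tlo) / (4 * a.thi) - m : ℚ) : ℝ) := by exact_mod_cast hbr
        push_cast at this; exact this
      have hΔ : ((gi.tlo : ℝ) - gp.thi) ≤ gi.theta - gp.theta := by linarith
      have hΔ0 : (0 : ℝ) ≤ (gi.tlo : ℝ) - gp.thi := by
        have : ((gp.thi : ℚ) : ℝ) < ((gi.tlo : ℚ) : ℝ) := by exact_mod_cast hsep
        linarith
      have hthi0 : (0 : ℝ) < a.thi := lt_of_lt_of_le (by exact_mod_cast htlo) (htloτ.trans hτthi)
      -- (tlo_i + tlo_p)/(4 thi) ≤ (θ_i + θ_p)/(4 τ)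
      have hfrac : ((gi.tlo : ℝ) + gp.tlo) / (4 * a.thi) ≤ (gi.theta + gp.theta) / (4 * a.tau) := by
        rw [div_le_div_iff₀ (by positivity) (by positivity)]
        have h1 : ((gi.tlo : ℝ) + gp.tlo) ≤ gi.theta + gp.theta := by linarith
        have h2 : (0 : ℝ) ≤ (gi.tlo : ℝ) + gp.tlo := by
          have : (0:ℝ) ≤ gi.tlo := by exact_mod_cast htli0
          have : (0:ℝ) ≤ gp.tlo := by exact_mod_cast htlp0
          linarith
        calc ((gi.tlo : ℝ) + gp.tlo) * (4 * a.tau) ≤ (gi.theta + gp.theta) * (4 * a.tau) :=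
              mul_le_mul_of_nonneg_right h1 (by positivity)
          _ ≤ (gi.theta + gp.theta) * (4 * a.thi) := by
              apply mul_le_mul_of_nonneg_left _ (by linarith)
              linarith
      have key : (gi.theta ^ 2 - gp.theta ^ 2) / (4 * a.tau) - (m : ℝ) * (gi.theta - gp.theta) =
          (gi.theta - gp.theta) * ((gi.theta + gp.theta) / (4 * a.tau) - m) := by ring
      rw [key]
      calc ((gi.tlo : ℝ) - gp.thi) * (((gi.tlo : ℝ) + gp.tlo) / (4 * a.thi) - m)
          ≤ (gi.theta - gp.theta) * (((gi.tlo : ℝ) + gp.tlo) / (4 * a.thi) - m) :=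
            mul_le_mul_of_nonneg_right hΔ hbr'
        _ ≤ (gi.theta - gp.theta) * ((gi.theta + gp.theta) / (4 * a.tau) - m) :=
            mul_le_mul_of_nonneg_left (by linarith) (by linarith)
    -- assemble: f θ_i - f θ_p = log Z_i - log Z_p + (θ_i² - θ_p²)/(4τ)
    have hf : a.f gi.theta - a.f gp.theta =
        Real.log (a.Zc gi.theta) - Real.log (a.Zc gp.theta) + (gi.theta ^ 2 - gp.theta ^ 2) / (4 * a.tau) := by
      unfold KAtom.f KAtom.Zc; ring
    linarith
  · exact hfall

/-- **`f'(θ_i) ≤ mhiEff`.** [folklore] -/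
theorem mhiEff_spec {a : KAtom} (ha : atomOK C a = true) (hg : gridOK C = true) (dhi : List ℚ) {i : ℕ}
    (hi : i < C.grid.length) :
    a.fd (C.grid.getD i gridD).theta ≤ ((mhiEff C a (rawTab C a) dhi i : ℚ) : ℝ) := by
  obtain ⟨_, hpt, _⟩ := gridOK_sound C hg
  have hτ := tau_pos C ha
  obtain ⟨_, _, _, htlo, htloτ, hτthi, _⟩ := atomOK_sound C ha
  have htlo0 : (0 : ℝ) < a.tlo := by exact_mod_cast htlo
  have hθπ : (C.grid.getD i gridD).theta ≤ Real.pi := (hpt i hi).2.2.2.2.2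
  -- the fallback bound
  have hfall : a.fd (C.grid.getD i gridD).theta ≤ (((piHi / (2 * a.tlo) : ℚ)) : ℝ) := by
    refine (fd_le_pi C ha hθπ).trans ?_
    push_cast
    rw [div_le_div_iff₀ (by positivity) (by positivity)]
    calc Real.pi * (2 * (a.tlo : ℝ)) ≤ Real.pi * (2 * a.tau) := by
          apply mul_le_mul_of_nonneg_left _ Real.pi_pos.le; linarith
      _ ≤ (piHi : ℝ) * (2 * a.tau) := mul_le_mul_of_nonneg_right pi_lt_piHi.le (by positivity)
  rw [mhiEff]
  dsimp only
  split_ifs with hlast hchk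
  · exact hfall
  · obtain ⟨hzi, hbr, hsep, hmfb, hexp⟩ := hchk
    set gi := C.grid.getD i gridD with hgi
    set gn := C.grid.getD (i + 1) gridD with hgn
    set m := dhi.getD i (piHi / (2 * a.tlo)) with hm
    have hin : i + 1 < C.grid.length := by omega
    obtain ⟨_, hlo_i, _, _⟩ := rawTab_spec C ha hg hi
    obtain ⟨_, _, hhi_n, hpos_n⟩ := rawTab_spec C ha hg hin
    rw [← hgi] at hlo_i
    rw [← hgn] at hhi_n
    have hθi := hpt i hi
    have hθn := hpt (i + 1) hin
    rw [← hgi] at hθi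
    rw [← hgn] at hθn
    obtain ⟨_, _, htli0, htli, hthi, _⟩ := hθi
    obtain ⟨_, _, htln0, htln, hthn, _⟩ := hθn
    have hlt : gi.theta < gn.theta := by
      have := theta_lt_succ C hg hin
      rwa [← hgi, ← hgn] at this
    have hslope : a.fd gi.theta ≤ slope a.f gi.theta gn.theta :=
      (convexOn_f C ha).le_slope_of_hasDerivAt (mem_univ _) (mem_univ _) hlt (hasDerivAt_f C ha _)
    refine hslope.trans ?_
    rw [slope_def_field, div_le_iff₀ (sub_pos.2 hlt)]
    -- need: f θ_n - f θ_i ≤ m (θ_n - θ_i)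
    have hzi' : (0 : ℝ) < ((((rawTab C a).getD i (0, 0)).1 : ℚ) : ℝ) := by exact_mod_cast hzi
    have hZi := Zc_pos C ha gi.theta
    have hZn := Zc_pos C ha gn.theta
    have hlog_i : Real.log ((((rawTab C a).getD i (0, 0)).1 : ℚ) : ℝ) ≤ Real.log (a.Zc gi.theta) :=
      Real.log_le_log hzi' hlo_i
    have hlog_n : Real.log (a.Zc gn.theta) ≤ Real.log ((((rawTab C a).getD (i + 1) (0, 0)).2 : ℚ) : ℝ) :=
      Real.log_le_log hZn hhi_n
    set Bx : ℚ := (gn.thi - gi.tlo) * ((gn.thi + gi.thi) / (4 * a.tlo) - m) with hBx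
    -- the exp check: zn * expHi(Bx) ≤ zi ⇒ log zn + Bx ≤ log zi
    have hexpR : ((((rawTab C a).getD (i + 1) (0, 0)).2 : ℚ) : ℝ) * Real.exp (Bx : ℝ) ≤
        ((((rawTab C a).getD i (0, 0)).1 : ℚ) : ℝ) := by
      have h1 : (((((rawTab C a).getD (i + 1) (0, 0)).2 * expHi Bx C.prec : ℚ)) : ℝ) ≤
          ((((rawTab C a).getD i (0, 0)).1 : ℚ) : ℝ) := by exact_mod_cast hexp
      push_cast at h1
      exact le_trans (mul_le_mul_of_nonneg_left (exp_le_expHi _ _) hpos_n.le) h1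
    have hlogB : Real.log ((((rawTab C a).getD (i + 1) (0, 0)).2 : ℚ) : ℝ) + (Bx : ℝ) ≤
        Real.log ((((rawTab C a).getD i (0, 0)).1 : ℚ) : ℝ) := by
      have := Real.log_le_log (mul_pos hpos_n (Real.exp_pos _)) hexpR
      rwa [Real.log_mul hpos_n.ne' (Real.exp_pos _).ne', Real.log_exp] at this
    -- bracket: (θ_n² - θ_i²)/(4τ) - m (θ_n - θ_i) ≤ Bx
    have hBr : (gn.theta ^ 2 - gi.theta ^ 2) / (4 * a.tau) - (m : ℝ) * (gn.theta - gi.theta) ≤ (Bx : ℝ) := by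
      rw [hBx]; push_cast
      have hthi0 : (0 : ℝ) < a.thi := lt_of_lt_of_le htlo0 (htloτ.trans hτthi)
      -- bracket ≥ 0 : m ≤ (tlo_n + tlo_i)/(4 thi) ≤ (θ_n + θ_i)/(4τ)
      have hbrR : (0 : ℝ) ≤ (((gn.tlo + gi.tlo) / (4 * a.thi) - m : ℚ) : ℝ) := by exact_mod_cast hbr
      push_cast at hbrR
      have hfrac1 : ((gn.tlo : ℝ) + gi.tlo) / (4 * a.thi) ≤ (gn.theta + gi.theta) / (4 * a.tau) := by
        rw [div_le_div_iff₀ (by positivity) (by positivity)]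
        have h1 : ((gn.tlo : ℝ) + gi.tlo) ≤ gn.theta + gi.theta := by linarith
        have h2 : (0 : ℝ) ≤ (gn.tlo : ℝ) + gi.tlo := by
          have : (0:ℝ) ≤ gn.tlo := by exact_mod_cast htln0
          have : (0:ℝ) ≤ gi.tlo := by exact_mod_cast htli0
          linarith
        calc ((gn.tlo : ℝ) + gi.tlo) * (4 * a.tau) ≤ (gn.theta + gi.theta) * (4 * a.tau) :=
              mul_le_mul_of_nonneg_right h1 (by positivity)
          _ ≤ (gn.theta + gi.theta) * (4 * a.thi) := by
              apply mul_le_mul_of_nonneg_left _ (by linarith); linarith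
      have hpos_br : (0 : ℝ) ≤ (gn.theta + gi.theta) / (4 * a.tau) - m := by linarith
      -- bracket ≤ (thi_n + thi_i)/(4 tlo) - m
      have hfrac2 : (gn.theta + gi.theta) / (4 * a.tau) ≤ ((gn.thi : ℝ) + gi.thi) / (4 * a.tlo) := by
        rw [div_le_div_iff₀ (by positivity) (by positivity)]
        have h0 : (0 : ℝ) ≤ gn.theta + gi.theta := by
          have : (0:ℝ) ≤ gn.tlo := by exact_mod_cast htln0
          have : (0:ℝ) ≤ gi.tlo := by exact_mod_cast htli0
          linarith
        calc (gn.theta + gi.theta) * (4 * (a.tlo : ℝ)) ≤ (gn.theta + gi.theta) * (4 * a.tau) :=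
              mul_le_mul_of_nonneg_left (by linarith) h0
          _ ≤ ((gn.thi : ℝ) + gi.thi) * (4 * a.tau) := mul_le_mul_of_nonneg_right (by linarith) (by positivity)
      have hΔ : gn.theta - gi.theta ≤ (gn.thi : ℝ) - gi.tlo := by linarith
      have hΔ0 : 0 ≤ gn.theta - gi.theta := by linarith
      have key : (gn.theta ^ 2 - gi.theta ^ 2) / (4 * a.tau) - (m : ℝ) * (gn.theta - gi.theta) =
          (gn.theta - gi.theta) * ((gn.theta + gi.theta) / (4 * a.tau) - m) := by ring
      rw [key]
      calc (gn.theta - gi.theta) * ((gn.theta + gi.theta) / (4 * a.tau) - m)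
          ≤ ((gn.thi : ℝ) - gi.tlo) * ((gn.theta + gi.theta) / (4 * a.tau) - m) :=
            mul_le_mul_of_nonneg_right hΔ hpos_br
        _ ≤ ((gn.thi : ℝ) - gi.tlo) * (((gn.thi : ℝ) + gi.thi) / (4 * a.tlo) - m) :=
            mul_le_mul_of_nonneg_left (by linarith) (hΔ0.trans hΔ)
    have hf : a.f gn.theta - a.f gi.theta =
        Real.log (a.Zc gn.theta) - Real.log (a.Zc gi.theta) + (gn.theta ^ 2 - gi.theta ^ 2) / (4 * a.tau) := by
      unfold KAtom.f KAtom.Zc; ring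
    linarith
  · exact hfall

end KCert

/-- Registered sub-goal marker `stub_certMid_part5` of crux stmt-SmoothPoincare4-7631 (helper file 5 of the kernel-clean
`stub_certMid`, line killing-flux): the π-enclosure used by the θ-grid. [folklore] -/
theorem stub_certMid_part5 : ((3.14159265358979323846 : ℚ) : ℝ) < Real.pi ∧ Real.pi < ((3.14159265358979323847 : ℚ) : ℝ) :=
  ⟨KCert.piLo_lt_pi, KCert.pi_lt_piHi⟩

end Summit.SmoothPoincare4.SmoothPoincare4.Cruxes.CylinderRungTwo.KillingFlux

end
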